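import Summits.QuantumFields.YangMills.Theorems.DirichletWindowAllSidesChessboardEvenCutWeightRP
import Summits.QuantumFields.YangMills.Theorems.BalabanLadderIROddTorusWeightedRP
import HarnessLib

/-!
# Weighted link reflection positivity and the reflection Cauchy–Schwarz inequality on the EVEN torus, with
# Chebyshev weights on the cut plaquettes

Support file for item stmt-QuantumFields-20194 (`DirichletWindow.AllSidesCouplingChessboard`, K1 of the large-field
sparsity line; seat ym-dw-p1 g3).  Even-side companion of the tree's `…BalabanLadderIROddTorusWeightedRP`.

On the even torus `(ℤ/Lℤ)^d`, `L = 2m`, with the Osterwalder–Seiler LINK reflection `θ t = 1 - t` (cuts between the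
slices `0 | 1` and `m | m+1`), let `W = exp(c ∑_{q ∈ B} φ_q)` (`φ_q = N - Re tr ρ U_q`, `SoloBlind.expObs ρ c B`) be
the Chebyshev weight of a set `B` of CUT plaquettes (temporal, base time `0` or `m`, `WilsonRP.IsCrossPlaq`) and
`0 ≤ c ≤ β`.  For real bounded measurable `F, G` depending only on the positive-time links `P`:

* `wilsonExpectation_mul_timeReflect_mul_expObs_nonneg_even` — `0 ≤ ⟨F · (F ∘ Θ) · W⟩_{Λ,β}` (coupling shift
  `β ↦ β - c`, then the cut plaquettes not in `B` carry the positive-definite weights `exp(+c Re tr ρ U_q)` of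
  `wilsonExpectation_mul_timeReflect_mul_expCut_nonneg_even`);
* `wilsonExpectation_mul_timeReflect_mul_expObs_symm_even` — `⟨F · (G ∘ Θ) · W⟩ = ⟨G · (F ∘ Θ) · W⟩`;
* `sq_wilsonExpectation_mul_timeReflect_mul_expObs_le_even` — `⟨F · (G ∘ Θ) · W⟩² ≤ ⟨F · (F ∘ Θ) · W⟩ · ⟨G · (G ∘ Θ) · W⟩`.

HONEST FRAMING: finite-torus reflection-positivity bookkeeping; no claim about the mass gap or infinite volume.
References: Osterwalder–Seiler, Ann. Phys. 110 (1978) §2; Seiler LNP 159 Ch. 2; Fröhlich–Israel–Lieb–Simon,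
CMP 62 (1978) Thm. 2.1.
-/

noncomputable section

open MeasureTheory Finset Filter Topology
open Literature.MathematicalPhysics.QuantumFieldTheory
open Literature.MathematicalPhysics.QuantumFieldTheory.WilsonRP
open Summit.QuantumFields.YangMills.Theorems.SoloBlind
open Summit.QuantumFields.YangMills.Theorems.OddTorusChessboard (wilsonExpectation_nonneg_of_shift expObs_eq_exp_mul_exp
  integrable_wilsonMeasure_of_abs_le)

namespace Summit.QuantumFields.YangMills.Theorems.AllSidesChessboard

variable {d L N : ℕ} [NeZero d] [NeZero L] {G : Type*} [Group G] [TopologicalSpace G]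
  [IsTopologicalGroup G] [CompactSpace G] [MeasurableSpace G] [BorelSpace G]
  (ρ : G →* Matrix (Fin N) (Fin N) ℂ)

/-! ### §1. The exponential of the split action on the even torus -/

section Split

variable [Fact (1 < L)]

omit [MeasurableSpace G] [BorelSpace G] in
/-- `e^{-cS} = e^{-cN#Λ₂} · e^{cA(U)} · e^{cA(ΘU)} · e^{cX(U)}` on the even torus (link reflection: no shared plaquettes). -/
theorem exp_neg_mul_wilsonAction_evenSplit (hL : Even L) (hρ : Continuous ρ) (c : ℝ) (U : GaugeConfig d L G) :
    Real.exp (-c * wilsonAction ρ U) =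
      Real.exp (-c * (N * Fintype.card (Plaquette d L))) * Real.exp (c * posAction ρ U) *
        Real.exp (c * posAction ρ U.timeReflect) * Real.exp (c * crossAction ρ U) := by
  rw [wilsonAction_split ρ hL hρ U, ← Real.exp_add, ← Real.exp_add, ← Real.exp_add]
  congr 1
  ring

omit [Fact (1 < L)] [TopologicalSpace G] [IsTopologicalGroup G] [CompactSpace G] [MeasurableSpace G]
  [BorelSpace G] in
/-- The crossing action splits over a subset `B` of the cut plaquettes. -/
theorem crossAction_eq_sum_add (B : Finset (Plaquette d L)) (hB : ∀ q ∈ B, IsCrossPlaq q) (U : GaugeConfig d L G) :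
    crossAction ρ U = ∑ q ∈ B, plaqRe ρ U q +
      ∑ q ∈ (univ.filter IsCrossPlaq) \ B, plaqRe ρ U q := by
  unfold crossAction
  have hsub : B ⊆ univ.filter IsCrossPlaq := fun q hq => Finset.mem_filter.2 ⟨Finset.mem_univ _, hB q hq⟩
  rw [← Finset.sum_sdiff hsub, add_comm]

end Split

/-! ### §2. Cut plaquettes are fixed by the reflection; positive observables live on `P` -/

section Geometry

variable [Fact (1 < L)]

omit [TopologicalSpace G] [IsTopologicalGroup G] [CompactSpace G] [MeasurableSpace G] [BorelSpace G] in
/-- A cut plaquette is fixed by the plaquette reflection `ϑ` (even torus). -/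
theorem plaqReflect_eq_self_of_isCrossPlaq (hL : Even L) {q : Plaquette d L} (hq : IsCrossPlaq q) :
    plaqReflect q = q := by
  obtain ⟨x, ⟨⟨i, j⟩, hij⟩⟩ := q
  obtain ⟨hi, ht⟩ := hq
  simp only at hi ht
  subst hi
  refine Prod.ext ?_ rfl
  simp only [plaqReflect, ↓reduceIte]
  funext k
  by_cases hk : k = 0
  · subst hk
    apply ZMod.val_injective
    rw [val_timeReflect_shift_zero]
    obtain ⟨m, hm⟩ := hL
    rcases ht with ht | ht
    · rw [if_pos ht, ht]
    · have hne : (x 0).val ≠ 0 := by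
        have h1L : 1 < L := Fact.out
        omega
      rw [if_neg hne, ht]
      omega
  · rw [timeReflect_apply_of_ne _ hk, shift_apply_of_ne _ hk]

omit [Fact (1 < L)] [MeasurableSpace G] [BorelSpace G] in
/-- The Chebyshev weight of a set of cut plaquettes is reflection invariant (even torus). -/
theorem expObs_timeReflect_of_isCrossPlaq (hL : Even L) (hρ : Continuous ρ) (c : ℝ)
    {B : Finset (Plaquette d L)} (hB : ∀ q ∈ B, IsCrossPlaq q) (U : GaugeConfig d L G) :
    expObs ρ c B U.timeReflect = expObs ρ c B U := by
  haveI : Fact (1 < L) := ⟨by obtain ⟨m, hm⟩ := hL; have := NeZero.ne L; omega⟩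
  rw [expObs_timeReflect ρ hρ]
  congr 1
  rw [Finset.image_congr (g := id) fun q hq => by
    simpa using plaqReflect_eq_self_of_isCrossPlaq hL (hB q (Finset.mem_coe.1 hq)), Finset.image_id]

omit [TopologicalSpace G] [IsTopologicalGroup G] [CompactSpace G] [MeasurableSpace G] [BorelSpace G] in
/-- `F_A` lives on the positive-time links when every plaquette of `A` is positive (even torus, link reflection). -/
theorem dependsOn_expObs_of_isPosPlaq (c : ℝ) {A : Finset (Plaquette d L)} (hA : ∀ q ∈ A, IsPosPlaq q) :
    DependsOn (expObs (G := G) ρ c A) ((posEdges : Finset (Edge d L)) : Set (Edge d L)) := by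
  intro U V hUV
  unfold expObs
  congr 2
  refine Finset.sum_congr rfl fun q hq => ?_
  obtain ⟨h1, h2, h3, h4⟩ := isPosEdge_of_isPosPlaq (hA q hq)
  have h : ∀ e, IsPosEdge e → U e = V e := fun e he => hUV e (by simpa using he)
  simp only [SoloBlind.plaquetteCost, plaquetteHolonomy, h _ h1, h _ h2, h _ h3, h _ h4]

end Geometry

/-! ### §3. Weighted link reflection positivity on the even torus -/

section Weighted

variable [Fact (1 < L)]

/-- **Weighted link reflection positivity on the even torus.**  `L` even, continuous `ρ`, `0 ≤ c ≤ β`; `B` a set of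
cut plaquettes; `F` real, measurable, bounded, depending only on the positive-time links.  Then
`0 ≤ ⟨F · (F ∘ Θ) · exp(c ∑_{q ∈ B} φ_q)⟩_{Λ,β}`. -/
theorem wilsonExpectation_mul_timeReflect_mul_expObs_nonneg_even (hL : Even L) (hρ : Continuous ρ)
    {β c : ℝ} (hc : 0 ≤ c) (hcβ : c ≤ β) {F : GaugeConfig d L G → ℝ} (hFm : Measurable F) {F₀ : ℝ}
    (hFb : ∀ U, |F U| ≤ F₀) (hFdep : DependsOn F ((posEdges : Finset (Edge d L)) : Set (Edge d L)))
    (B : Finset (Plaquette d L)) (hB : ∀ q ∈ B, IsCrossPlaq q) :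
    0 ≤ wilsonExpectation ρ β fun U : GaugeConfig d L G => F U * F U.timeReflect * expObs ρ c B U := by
  classical
  refine wilsonExpectation_nonneg_of_shift ρ hρ β c _ ?_
  -- at coupling `β - c`: `F·FΘ·expObs c B · e^{-cS} = const · K · (K ∘ Θ) · exp(c ∑_{cut q ∉ B} Re tr ρ U_q)`
  set E : Finset (Plaquette d L) := (univ.filter IsCrossPlaq) \ B with hE
  have hE' : ∀ q ∈ E, IsCrossPlaq q := fun q hq =>
    (Finset.mem_filter.1 (Finset.mem_sdiff.1 hq).1).2
  set K : GaugeConfig d L G → ℝ := fun U => F U * Real.exp (c * posAction ρ U) with hK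
  set κ : ℝ := Real.exp (c * (N * B.card)) * Real.exp (-c * (N * Fintype.card (Plaquette d L))) with hκ
  have hκ0 : 0 ≤ κ := mul_nonneg (Real.exp_pos _).le (Real.exp_pos _).le
  have hpt : ∀ U : GaugeConfig d L G,
      F U * F U.timeReflect * expObs ρ c B U * Real.exp (-c * wilsonAction ρ U) =
        κ * (K U * K U.timeReflect * Real.exp (c * ∑ q ∈ E, plaqRe ρ U q)) := by
    intro U
    rw [expObs_eq_exp_mul_exp, exp_neg_mul_wilsonAction_evenSplit ρ hL hρ c U,
      crossAction_eq_sum_add ρ B hB U, hK, hκ]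
    simp only
    rw [mul_add, Real.exp_add, ← hE,
      show Real.exp (-c * ∑ q ∈ B, plaqRe ρ U q) = (Real.exp (c * ∑ q ∈ B, plaqRe ρ U q))⁻¹ by
        rw [neg_mul, Real.exp_neg]]
    field_simp
  rw [show (fun U : GaugeConfig d L G => F U * F U.timeReflect * expObs ρ c B U *
      Real.exp (-c * wilsonAction ρ U)) =
      fun U => κ * (K U * K U.timeReflect * Real.exp (c * ∑ q ∈ E, plaqRe ρ U q)) from funext hpt]
  unfold wilsonExpectation
  rw [integral_const_mul]
  refine mul_nonneg hκ0 ?_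
  obtain ⟨A₀, hA₀⟩ : ∃ A₀ : ℝ, ∀ U : GaugeConfig d L G, |Real.exp (c * posAction ρ U)| ≤ A₀ := by
    refine ⟨Real.exp (|c| * (N * Fintype.card (Plaquette d L))), fun U => ?_⟩
    rw [Real.abs_exp]
    refine Real.exp_le_exp.2 ?_
    calc c * posAction ρ U ≤ |c * posAction ρ U| := le_abs_self _
      _ = |c| * |posAction ρ U| := abs_mul _ _
      _ ≤ |c| * (N * Fintype.card (Plaquette d L)) :=
          mul_le_mul_of_nonneg_left (WilsonOddRP.abs_sum_filter_plaqRe_le ρ hρ _ U) (abs_nonneg _)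
  have hF0 : 0 ≤ F₀ := (abs_nonneg _).trans (hFb fun _ => 1)
  have hKm : Measurable K := hFm.mul ((measurable_posAction ρ hρ).const_mul c).exp
  have hKb : ∀ U, |K U| ≤ F₀ * A₀ := fun U => by
    rw [hK]; simp only; rw [abs_mul]
    exact mul_le_mul (hFb U) (hA₀ U) (abs_nonneg _) hF0
  have hKdep : DependsOn K ((posEdges : Finset (Edge d L)) : Set (Edge d L)) := fun U W hUW => by
    simp only [hK]
    rw [hFdep hUW, dependsOn_posAction ρ hUW]
  exact wilsonExpectation_mul_timeReflect_mul_expCut_nonneg_even ρ hL hρ (by linarith) hc hKm hKb hKdep E hE'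

/-! ### §4. Symmetry and the reflection Cauchy–Schwarz inequality with Chebyshev weights -/

omit [Fact (1 < L)] in
/-- **Symmetry of the weighted Osterwalder–Schrader form** (even torus): `⟨F · (G ∘ Θ) · W⟩ = ⟨G · (F ∘ Θ) · W⟩`. -/
theorem wilsonExpectation_mul_timeReflect_mul_expObs_symm_even (hL : Even L) (hρ : Continuous ρ) (β c : ℝ)
    (F G' : GaugeConfig d L G → ℝ) {B : Finset (Plaquette d L)} (hB : ∀ q ∈ B, IsCrossPlaq q) :
    (wilsonExpectation ρ β fun U : GaugeConfig d L G => F U * G' U.timeReflect * expObs ρ c B U) =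
      wilsonExpectation ρ β fun U : GaugeConfig d L G => G' U * F U.timeReflect * expObs ρ c B U := by
  rw [← wilsonExpectation_comp_timeReflect ρ hρ β
    (fun U : GaugeConfig d L G => G' U * F U.timeReflect * expObs ρ c B U)]
  congr 1
  funext U
  simp only [timeReflect_timeReflect_config, expObs_timeReflect_of_isCrossPlaq ρ hL hρ c hB]
  ring

/-- **The link-reflection Cauchy–Schwarz inequality with Chebyshev cut weights on the even torus**: `L` even,
continuous `ρ`, `0 ≤ c ≤ β`, `B` a set of cut plaquettes, `F, G` real bounded measurable depending only on the
positive-time links: `⟨F · (G ∘ Θ) · W⟩² ≤ ⟨F · (F ∘ Θ) · W⟩ · ⟨G · (G ∘ Θ) · W⟩`, `W = exp(c ∑_{q ∈ B} φ_q)`. -/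
theorem sq_wilsonExpectation_mul_timeReflect_mul_expObs_le_even (hL : Even L) (hρ : Continuous ρ)
    {β c : ℝ} (hc : 0 ≤ c) (hcβ : c ≤ β)
    {F : GaugeConfig d L G → ℝ} (hFm : Measurable F) {F₀ : ℝ} (hFb : ∀ U, |F U| ≤ F₀)
    (hFdep : DependsOn F ((posEdges : Finset (Edge d L)) : Set (Edge d L)))
    {G' : GaugeConfig d L G → ℝ} (hGm : Measurable G') {G₀ : ℝ} (hGb : ∀ U, |G' U| ≤ G₀)
    (hGdep : DependsOn G' ((posEdges : Finset (Edge d L)) : Set (Edge d L)))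
    (B : Finset (Plaquette d L)) (hB : ∀ q ∈ B, IsCrossPlaq q) :
    (wilsonExpectation ρ β fun U : GaugeConfig d L G => F U * G' U.timeReflect * expObs ρ c B U) ^ 2 ≤
      (wilsonExpectation ρ β fun U : GaugeConfig d L G => F U * F U.timeReflect * expObs ρ c B U) *
        (wilsonExpectation ρ β fun U : GaugeConfig d L G => G' U * G' U.timeReflect * expObs ρ c B U) := by
  have hΘm : Measurable (GaugeConfig.timeReflect : GaugeConfig d L G → GaugeConfig d L G) :=
    measurable_timeReflect
  have hWm : Measurable (expObs (G := G) ρ c B) := measurable_expObs ρ hρ c B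
  obtain ⟨W₀, hWb⟩ := exists_abs_expObs_le (G := G) ρ hρ c B
  have hF0 : 0 ≤ F₀ := (abs_nonneg _).trans (hFb fun _ => 1)
  have hG0 : 0 ≤ G₀ := (abs_nonneg _).trans (hGb fun _ => 1)
  set a := wilsonExpectation ρ β fun U : GaugeConfig d L G => F U * F U.timeReflect * expObs ρ c B U with ha
  set b := wilsonExpectation ρ β fun U : GaugeConfig d L G => F U * G' U.timeReflect * expObs ρ c B U with hb
  set e := wilsonExpectation ρ β fun U : GaugeConfig d L G => G' U * G' U.timeReflect * expObs ρ c B U with he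
  have hsymm : (wilsonExpectation ρ β fun U : GaugeConfig d L G => G' U * F U.timeReflect * expObs ρ c B U) = b :=
    (wilsonExpectation_mul_timeReflect_mul_expObs_symm_even ρ hL hρ β c F G' hB).symm
  have hint : ∀ (X Y : GaugeConfig d L G → ℝ), Measurable X → Measurable Y → ∀ (X₀ Y₀ : ℝ),
      (∀ U, |X U| ≤ X₀) → (∀ U, |Y U| ≤ Y₀) →
      Integrable (fun U : GaugeConfig d L G => X U * Y U.timeReflect * expObs ρ c B U) (wilsonMeasure ρ β) := by
    intro X Y hXm hYm X₀ Y₀ hXb hYb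
    refine integrable_wilsonMeasure_of_abs_le ρ hρ β ((hXm.mul (hYm.comp hΘm)).mul hWm)
      (C := X₀ * Y₀ * W₀) fun U => ?_
    rw [abs_mul, abs_mul]
    have hX0 : 0 ≤ X₀ := (abs_nonneg _).trans (hXb U)
    exact mul_le_mul (mul_le_mul (hXb U) (hYb _) (abs_nonneg _) hX0) (hWb U) (abs_nonneg _)
      (mul_nonneg hX0 ((abs_nonneg _).trans (hYb U)))
  have hquad : ∀ t : ℝ, 0 ≤ e * (t * t) + (2 * b) * t + a := by
    intro t
    have hHm : Measurable fun U => F U + t * G' U := hFm.add (hGm.const_mul t)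
    have hHb : ∀ U, |F U + t * G' U| ≤ F₀ + |t| * G₀ := fun U =>
      (abs_add_le _ _).trans (add_le_add (hFb U) (by rw [abs_mul]; exact mul_le_mul_of_nonneg_left (hGb U) (abs_nonneg t)))
    have hHdep : DependsOn (fun U => F U + t * G' U) ((posEdges : Finset (Edge d L)) : Set (Edge d L)) :=
      fun U V hUV => by simp only; rw [hFdep hUV, hGdep hUV]
    have h := wilsonExpectation_mul_timeReflect_mul_expObs_nonneg_even ρ hL hρ hc hcβ hHm hHb hHdep B hB
    have hexp : (wilsonExpectation ρ β fun U : GaugeConfig d L G =>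
        (F U + t * G' U) * (F U.timeReflect + t * G' U.timeReflect) * expObs ρ c B U) =
        a + t * b + t * (wilsonExpectation ρ β fun U : GaugeConfig d L G =>
          G' U * F U.timeReflect * expObs ρ c B U) + t * t * e := by
      have e1 : (fun U : GaugeConfig d L G =>
          (F U + t * G' U) * (F U.timeReflect + t * G' U.timeReflect) * expObs ρ c B U) = fun U =>
          (F U * F U.timeReflect * expObs ρ c B U + t * (F U * G' U.timeReflect * expObs ρ c B U)) +
          (t * (G' U * F U.timeReflect * expObs ρ c B U) + t * t * (G' U * G' U.timeReflect * expObs ρ c B U)) := by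
        funext U; ring
      have iFF := hint F F hFm hFm F₀ F₀ hFb hFb
      have iFG := hint F G' hFm hGm F₀ G₀ hFb hGb
      have iGF := hint G' F hGm hFm G₀ F₀ hGb hFb
      have iGG := hint G' G' hGm hGm G₀ G₀ hGb hGb
      have i3 : Integrable (fun U : GaugeConfig d L G => t * (F U * G' U.timeReflect * expObs ρ c B U))
          (wilsonMeasure ρ β) := iFG.const_mul t
      have i4 : Integrable (fun U : GaugeConfig d L G => t * (G' U * F U.timeReflect * expObs ρ c B U))
          (wilsonMeasure ρ β) := iGF.const_mul t
      have i5 : Integrable (fun U : GaugeConfig d L G => t * t * (G' U * G' U.timeReflect * expObs ρ c B U))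
          (wilsonMeasure ρ β) := iGG.const_mul _
      have i1 : Integrable (fun U : GaugeConfig d L G =>
          F U * F U.timeReflect * expObs ρ c B U + t * (F U * G' U.timeReflect * expObs ρ c B U))
          (wilsonMeasure ρ β) := iFF.add i3
      have i2 : Integrable (fun U : GaugeConfig d L G =>
          t * (G' U * F U.timeReflect * expObs ρ c B U) + t * t * (G' U * G' U.timeReflect * expObs ρ c B U))
          (wilsonMeasure ρ β) := i4.add i5
      unfold wilsonExpectation at *
      rw [e1, integral_add i1 i2, integral_add iFF i3, integral_add i4 i5,
        integral_const_mul, integral_const_mul, integral_const_mul, ha, hb, he]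
      beta_reduce
      ring
    rw [hexp, hsymm] at h
    nlinarith [h]
  have hdisc := discrim_le_zero hquad
  rw [discrim] at hdisc
  nlinarith [hdisc]

end Weighted

end Summit.QuantumFields.YangMills.Theorems.AllSidesChessboard

end
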